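import Literature.NumberTheory.Automorphic.ReductionTheoryGLnConjugation
import Literature.NumberTheory.Automorphic.SmallRationalAdeles
import HarnessLib

/-!
# Rational points in the conjugate `a Ω a⁻¹` of a compact set by the torus: contracted entries vanish
(Godement, *Domaines fondamentaux des groupes arithmétiques*, Sém. Bourbaki 257 (1962/63), §10,
Lemme 3 in the proof of Théorème 9 (Borel's "Siegel property"); Garrett, *Modern Analysis of
Automorphic Forms by Example* (2018), Claim 7.3.6; Getz–Hahn, *An Introduction to Automorphic
Representations* (2024), §9.5)

A brick of the basic estimate for cusp forms on a Siegel set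
(`GLnCuspidalSpectrum.norm_smoothedForm_le_of_isSiegelSetGL`, Garrett Thm. 7.3.10 / Getz–Hahn
Prop. 9.6.1: the multiplicity of `N(K)\N(K) x Ω → GL_n(K)\GL_n(𝔸_K)` over a Siegel set) and of
every truncation argument on `GL_n(K)\GL_n(𝔸_K)`: **a rational matrix lying in `a Ω a⁻¹`,
`Ω ⊆ GL_n(𝔸_K)` compact, `a = diag(t₁, …, tₙ)` positive real (archimedean) diagonal, has
`γ_{ij} = 0` at every position where the torus contracts enough, `t_i / t_j ≤ ε(Ω)`.** Indeed
`(a ω a⁻¹)_{ij} = (t_i/t_j, 1) · ω_{ij}` (the real scalar acting on the archimedean components,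
`coe_posRealDiagonal_mul_mul_inv_apply`), the entries `ω_{ij}`, `ω ∈ Ω`, range in a compact subset
of `𝔸_K`, and a principal adele whose finite part lies in a compact set and whose archimedean part
is `(real scalar ≤ ε) × (bounded)` vanishes for `ε` small — the product formula in the form of the
tree's `exists_nhds_forall_algebraMap_eq_zero` / `exists_pos_forall_sum_realToInfiniteAdele_mul_mem`
(`SmallRationalAdeles`). This is the `GL_n`, entrywise form of the dichotomy in Godement's proof
of Borel's Siegel property (loc. cit., Lemme 3: for `σ'γ ∩ σ'' ≠ ∅`, `γ ∈ P_k w P_k`, "for every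
`j` either `α_j(t')` stays away from `0` or `w ∈ P(j)`"), i.e. of the classical statement
"`γ 𝔖 ∩ 𝔖' ≠ ∅` with `𝔖'` high in the `P`-cusp forces `γ ∈ P(K)`"; the parabolic forms follow by
choosing the block labelling:

* `exists_pos_forall_apply_eq_zero_of_map_eq_conj` — the entrywise statement above;
* `exists_pos_forall_mem_standardParabolicGL_of_map_eq_conj` — **parabolic form**: if
  `t_i / t_j ≤ ε` whenever `c j < c i` (the torus contracts across the blocks of a labelling
  `c : Fin n → α`), then `γ ∈ P_c(K)` (`standardParabolicGL K c` of `ParabolicGL`), and its image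
  lies in `P_c(𝔸_K)` (`map_mem_standardParabolicGL_of_mem`);
* `exists_pos_forall_mem_standardParabolicGL_of_mem_conj` — the same for `g ∈ GL_n(K)` given as
  an element of `rationalPointsGL n K ≤ GL_n(𝔸_K)` (`ReductionTheoryGLn`) with `g = a ω a⁻¹`.

The two-sided unipotent factors of the classical formulations (`γ ∈ N(𝔸) a Ω a⁻¹ N(𝔸)`) are
removed by the consumer with `N(𝔸_K) = N(K) · C_N` (`UnipotentAdelicCompact`) and the conjugation
lemma `a⁻¹ C_N a ⊆ C'` on the cone (`ReductionTheoryGLnConjugation`), which put them into `Ω`;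
`ε` depends on `Ω` only, so one `ε` serves all block labellings at once (all standard parabolics
`P_J`, `J` the set of contracting simple roots).

## References

* R. Godement, *Domaines fondamentaux des groupes arithmétiques*, Sém. Bourbaki 257 (1962/63),
  §10, Théorème 9 and Lemmes 1–4 (English translation in Borel–Godement–Siegel–Weil (2020), PDF
  pp. 170–172 of the held copy) [Godement1964].
* P. Garrett, *Modern Analysis of Automorphic Forms by Example* (2018), Claim 7.3.6 (PDF p. 336)
  [Garrett2018].
* J. R. Getz, H. Hahn, *An Introduction to Automorphic Representations*, GTM 300 (2024), §9.5
  (printed pp. 186–188) [GetzHahn2024].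
* A. Borel, *Introduction aux groupes arithmétiques*, Hermann (1969), Prop. 12.6, Thm. 15.4;
  Harish-Chandra, *Automorphic forms on semisimple Lie groups*, LNM 62 (1968), Ch. I, Lemma 8.
-/

noncomputable section

open scoped NNReal MatrixGroups Pointwise Topology
open NumberField IsDedekindDomain Set Filter

namespace Literature.NumberTheory.Automorphic

variable {n : ℕ} {K : Type} [Field K] [NumberField K]

/-! ### Entries of `a ω a⁻¹` -/

/-- **Entries of `a ω a⁻¹`.** For a positive real diagonal `a = diag(t₁, …, tₙ)` (`posRealDiagonal`)
and any adelic matrix `ω`, the `(i, j)` entry of `a ω a⁻¹` is `(t_i / t_j, 1) · ω_{ij}`, the real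
scalar `t_i/t_j` acting on the archimedean components only (`realAdele`; the companion of
`coe_posRealDiagonal_inv_mul_mul_posRealDiagonal_apply`, conjugation the other way round).
[cite: Garrett2018, Claim 7.3.6 (PDF p. 336)] -/
theorem coe_posRealDiagonal_mul_mul_inv_apply (t : Fin n → ℝ≥0ˣ)
    (ω : GL (Fin n) (AdeleRing (𝓞 K) K)) (i j : Fin n) :
    ((posRealDiagonal n K t * ω * (posRealDiagonal n K t)⁻¹ : GL (Fin n) (AdeleRing (𝓞 K) K)) :
        Matrix (Fin n) (Fin n) (AdeleRing (𝓞 K) K)) i j =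
      realAdele K (((t i : ℝ≥0) : ℝ) / ((t j : ℝ≥0) : ℝ)) *
        (ω : Matrix (Fin n) (Fin n) (AdeleRing (𝓞 K) K)) i j := by
  have h := coe_posRealDiagonal_inv_mul_mul_posRealDiagonal_apply (K := K) t⁻¹ ω i j
  rw [map_inv, inv_inv] at h
  rw [h, Pi.inv_apply, Pi.inv_apply, Units.val_inv_eq_inv_val, Units.val_inv_eq_inv_val,
    NNReal.coe_inv, NNReal.coe_inv, inv_div_inv]

/-- The archimedean and finite components of `(r, 1) · x`: `((r, 1) · x)_∞ = r · x_∞` and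
`((r, 1) · x)_f = x_f`. [folklore] -/
theorem realAdele_mul_fst_snd (r : ℝ) (x : AdeleRing (𝓞 K) K) :
    (realAdele K r * x).1 = realToInfiniteAdele K r * x.1 ∧ (realAdele K r * x).2 = x.2 :=
  ⟨rfl, by change (1 : FiniteAdeleRing (𝓞 K) K) * x.2 = x.2; rw [one_mul]⟩

/-! ### Contracted entries of rational points vanish -/

/-- **Contracted entries of rational points in `a Ω a⁻¹` vanish.** For every compact
`Ω ⊆ GL_n(𝔸_K)` there is `ε > 0` such that: if `γ ∈ GL_n(K)` and its diagonal image in `GL_n(𝔸_K)`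
equals `a ω a⁻¹` with `ω ∈ Ω` and `a = diag(t)` positive real diagonal, then `γ_{ij} = 0` for all
`(i, j)` with `t_i / t_j ≤ ε`. Proof: `γ_{ij}`, as a principal adele, is `(t_i/t_j, 1) · ω_{ij}`;
its finite part lies in the compact set of finite parts of entries of `Ω`, its archimedean part is
a real scalar `≤ ε` times a point of the compact set of archimedean parts of entries of `Ω`, and
such a principal adele is `0` once `ε` is small (`exists_nhds_forall_algebraMap_eq_zero`,
`exists_pos_forall_sum_realToInfiniteAdele_mul_mem`: a non-zero `k ∈ K` cannot be small at every
archimedean place while integral-up-to-a-fixed-denominator at the finite ones — the product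
formula). This is the mechanism of Godement's proof of Borel's Siegel property (Sém. Bourbaki
257, §10, Lemme 3: "either `α_j(t')` stays away from zero or `w ∈ P(j)`"), in entrywise form
for `GL_n`. [cite: Godement1964, §10, Lemme 3 (proof of Théorème 9)] -/
theorem exists_pos_forall_apply_eq_zero_of_map_eq_conj
    {Ω : Set (GL (Fin n) (AdeleRing (𝓞 K) K))} (hΩ : IsCompact Ω) :
    ∃ ε : ℝ, 0 < ε ∧ ∀ (t : Fin n → ℝ≥0ˣ) (γ : GL (Fin n) K), ∀ ω ∈ Ω,
      Matrix.GeneralLinearGroup.map (algebraMap K (AdeleRing (𝓞 K) K)) γ =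
          posRealDiagonal n K t * ω * (posRealDiagonal n K t)⁻¹ →
        ∀ i j : Fin n, ((t i : ℝ≥0) : ℝ) / ((t j : ℝ≥0) : ℝ) ≤ ε →
          (γ : Matrix (Fin n) (Fin n) K) i j = 0 := by
  -- the entry maps and the compact sets of archimedean / finite parts of entries of `Ω`
  have hval : Continuous fun ω : GL (Fin n) (AdeleRing (𝓞 K) K) =>
      (ω : Matrix (Fin n) (Fin n) (AdeleRing (𝓞 K) K)) := Units.continuous_val
  have hcont : ∀ i j : Fin n, Continuous fun ω : GL (Fin n) (AdeleRing (𝓞 K) K) =>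
      (ω : Matrix (Fin n) (Fin n) (AdeleRing (𝓞 K) K)) i j := fun i j => hval.matrix_elem i j
  set Bf : Set (FiniteAdeleRing (𝓞 K) K) :=
    ⋃ i : Fin n, ⋃ j : Fin n, (fun ω : GL (Fin n) (AdeleRing (𝓞 K) K) =>
      ((ω : Matrix (Fin n) (Fin n) (AdeleRing (𝓞 K) K)) i j).2) '' Ω with hBf
  set Bi : Set (InfiniteAdeleRing K) :=
    ⋃ i : Fin n, ⋃ j : Fin n, (fun ω : GL (Fin n) (AdeleRing (𝓞 K) K) =>
      ((ω : Matrix (Fin n) (Fin n) (AdeleRing (𝓞 K) K)) i j).1) '' Ω with hBi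
  have hBfc : IsCompact Bf :=
    isCompact_iUnion fun i => isCompact_iUnion fun j =>
      hΩ.image (continuous_snd.comp (hcont i j))
  have hBic : IsCompact Bi :=
    isCompact_iUnion fun i => isCompact_iUnion fun j =>
      hΩ.image (continuous_fst.comp (hcont i j))
  obtain ⟨W, hW, hWzero⟩ := exists_nhds_forall_algebraMap_eq_zero (K := K) hBfc
  obtain ⟨ε, hε, hεW⟩ := exists_pos_forall_sum_realToInfiniteAdele_mul_mem (K := K) hW hBic 1
  refine ⟨ε, hε, fun t γ ω hω hγ i j hij => ?_⟩
  -- the `(i, j)` entry of `γ` as a principal adele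
  have hentry : algebraMap K (AdeleRing (𝓞 K) K) ((γ : Matrix (Fin n) (Fin n) K) i j) =
      realAdele K (((t i : ℝ≥0) : ℝ) / ((t j : ℝ≥0) : ℝ)) *
        (ω : Matrix (Fin n) (Fin n) (AdeleRing (𝓞 K) K)) i j := by
    have h : ((Matrix.GeneralLinearGroup.map (algebraMap K (AdeleRing (𝓞 K) K)) γ :
        GL (Fin n) (AdeleRing (𝓞 K) K)) : Matrix (Fin n) (Fin n) (AdeleRing (𝓞 K) K)) i j =
        ((posRealDiagonal n K t * ω * (posRealDiagonal n K t)⁻¹ : GL (Fin n) (AdeleRing (𝓞 K) K)) :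
          Matrix (Fin n) (Fin n) (AdeleRing (𝓞 K) K)) i j := by rw [hγ]
    rw [coe_posRealDiagonal_mul_mul_inv_apply, Matrix.GeneralLinearGroup.map_apply] at h
    exact h
  refine hWzero _ ?_ ?_
  · -- finite part: an entry of `ω ∈ Ω`
    rw [hentry, (realAdele_mul_fst_snd _ _).2]
    exact mem_iUnion.2 ⟨i, mem_iUnion.2 ⟨j, mem_image_of_mem _ hω⟩⟩
  · -- archimedean part: `(t_i/t_j) · (ω_{ij})_∞` with `t_i/t_j ≤ ε`
    rw [hentry, (realAdele_mul_fst_snd _ _).1]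
    have h := hεW (fun _ => ((t i : ℝ≥0) : ℝ) / ((t j : ℝ≥0) : ℝ))
      (fun _ => ((ω : Matrix (Fin n) (Fin n) (AdeleRing (𝓞 K) K)) i j).1)
      (fun _ => by rw [abs_of_nonneg (by positivity)]; exact hij)
      (fun _ => mem_iUnion.2 ⟨i, mem_iUnion.2 ⟨j, mem_image_of_mem _ hω⟩⟩)
    simpa using h

/-! ### Parabolic form -/

/-- A block triangular matrix stays block triangular under an entrywise ring homomorphism; in
particular the diagonal image of `γ ∈ P_c(K)` lies in `P_c(𝔸_K)`. [folklore] -/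
theorem map_mem_standardParabolicGL_of_mem {R S : Type*} [CommRing R] [CommRing S] (f : R →+* S)
    {α : Type*} [LinearOrder α] (c : Fin n → α) {γ : GL (Fin n) R}
    (hγ : γ ∈ standardParabolicGL R c) :
    Matrix.GeneralLinearGroup.map f γ ∈ standardParabolicGL S c := by
  rw [mem_standardParabolicGL_iff] at hγ ⊢
  intro i j hij
  rw [Matrix.GeneralLinearGroup.map_apply]
  change f ((γ : Matrix (Fin n) (Fin n) R) i j) = 0
  rw [hγ hij, map_zero]

/-- **Parabolic form of the contraction lemma.** For every compact `Ω ⊆ GL_n(𝔸_K)` there is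
`ε > 0` such that for every block labelling `c : Fin n → α`, every positive real diagonal
`a = diag(t)` contracting by at least `ε` across the blocks of `c` (`t_i / t_j ≤ ε` whenever
`c j < c i`) and every `γ ∈ GL_n(K)` whose diagonal image is `a ω a⁻¹` with `ω ∈ Ω`, one has
`γ ∈ P_c(K)` (`standardParabolicGL K c`): the entries below the block diagonal are contracted,
hence vanish (`exists_pos_forall_apply_eq_zero_of_map_eq_conj`). With `c` the labelling of the
maximal parabolic `P(j)` this is the dichotomy of Godement's Lemme 3 ("either `α_j(t')` stays away
from zero or `w ∈ P(j)`", `γ ∈ P_k w P_k`); `ε` depends on `Ω` only, not on `c`.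
[cite: Godement1964, §10, Lemme 3 (proof of Théorème 9)] -/
theorem exists_pos_forall_mem_standardParabolicGL_of_map_eq_conj
    {Ω : Set (GL (Fin n) (AdeleRing (𝓞 K) K))} (hΩ : IsCompact Ω) :
    ∃ ε : ℝ, 0 < ε ∧ ∀ {α : Type} [LinearOrder α] (c : Fin n → α) (t : Fin n → ℝ≥0ˣ),
      (∀ i j : Fin n, c j < c i → ((t i : ℝ≥0) : ℝ) / ((t j : ℝ≥0) : ℝ) ≤ ε) →
      ∀ (γ : GL (Fin n) K), ∀ ω ∈ Ω,
        Matrix.GeneralLinearGroup.map (algebraMap K (AdeleRing (𝓞 K) K)) γ =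
            posRealDiagonal n K t * ω * (posRealDiagonal n K t)⁻¹ →
          γ ∈ standardParabolicGL K c := by
  obtain ⟨ε, hε, h⟩ := exists_pos_forall_apply_eq_zero_of_map_eq_conj hΩ
  refine ⟨ε, hε, fun c t hc γ ω hω hγ => ?_⟩
  rw [mem_standardParabolicGL_iff]
  intro i j hij
  exact h t γ ω hω hγ i j (hc i j hij)

/-- **The contraction lemma for rational points of `GL_n(𝔸_K)`.** For every compact
`Ω ⊆ GL_n(𝔸_K)` there is `ε > 0` such that for every block labelling `c`, every positive real
diagonal `a = diag(t)` with `t_i / t_j ≤ ε` whenever `c j < c i`, and every rational point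
`g ∈ GL_n(K) ≤ GL_n(𝔸_K)` (`rationalPointsGL n K`) of the form `a ω a⁻¹`, `ω ∈ Ω`, `g` is block upper
triangular: `g ∈ P_c(𝔸_K)`, indeed `g` is the image of an element of `P_c(K)` (Godement, Sém.
Bourbaki 257, §9, Lemme 3; Borel (1969), Prop. 12.6). [cite: Godement1964, §10, Lemme 3 (proof of Théorème 9)] -/
theorem exists_pos_forall_mem_standardParabolicGL_of_mem_conj
    {Ω : Set (GL (Fin n) (AdeleRing (𝓞 K) K))} (hΩ : IsCompact Ω) :
    ∃ ε : ℝ, 0 < ε ∧ ∀ {α : Type} [LinearOrder α] (c : Fin n → α) (t : Fin n → ℝ≥0ˣ),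
      (∀ i j : Fin n, c j < c i → ((t i : ℝ≥0) : ℝ) / ((t j : ℝ≥0) : ℝ) ≤ ε) →
      ∀ g ∈ rationalPointsGL n K,
        (∃ ω ∈ Ω, g = posRealDiagonal n K t * ω * (posRealDiagonal n K t)⁻¹) →
          ∃ γ ∈ standardParabolicGL K c,
            Matrix.GeneralLinearGroup.map (algebraMap K (AdeleRing (𝓞 K) K)) γ = g ∧
            g ∈ standardParabolicGL (AdeleRing (𝓞 K) K) c := by
  obtain ⟨ε, hε, h⟩ := exists_pos_forall_mem_standardParabolicGL_of_map_eq_conj hΩ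
  refine ⟨ε, hε, fun c t hc g hg hmem => ?_⟩
  obtain ⟨γ, rfl⟩ := hg
  obtain ⟨ω, hω, hγω⟩ := hmem
  have hγ : γ ∈ standardParabolicGL K c := h c t hc γ ω hω hγω
  exact ⟨γ, hγ, rfl, map_mem_standardParabolicGL_of_mem _ c hγ⟩

end Literature.NumberTheory.Automorphic
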